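import Mathlib
import HarnessLib
import Literature.NumberTheory.LFunctions.ZetaScrew
import Summits.RiemannHypothesis.RiemannHypothesis.Theorems.IntegerScrewKNodeFloor

/-!
# Route `IntegerScrew` — the CONTINUUM FLOOR of the pivot deficit as one series:
# `liminf G(M)·log M ≥ V/2 = Σ_{k≥1} (c_k/2)²` along `S_{M−1} ≻ 0` (PIVOT-LAW §15.4; RH-FREE)

`IntegerScrewKNodeFloor.eventually_kNode_deficit_floor` gives the floor `S_K − ε` for every finite
number `K` of lags.  Here the constants are summed: with `c_k/2 = −½Δ²[k log k]`,
`0 ≤ Δ²[k log k] ≤ 3/k` (`k ≥ 2`; elementary `log` inequalities), so `Σ_k (c_k/2)²` converges, and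

* `eventually_deficit_floor_series` : for every `δ > 0`, eventually in `M`,
  `S_{M−1} ≻ 0 → Σ'_k (c_k/2)² − δ ≤ G(M)·log M`.

`Σ_{k≥1}(c_k/2)² = ¼Σ_{k≥1}(Δ²[k log k])² = 0.6493591…` is the Szegő continuum constant `V/2` of
PIVOT-LAW §8.14–8.16 in closed form (§15.4; the numerical value is not asserted in the kernel).  Lower
bounds on the deficit point away from RH; nothing here bears on the truth of RH. [Suzuki2023, (1.1)]
-/

noncomputable section

-- D-0017: `Summit.<S>.<S>.…` is the designed namespace of a single-problem summit.
set_option linter.dupNamespace false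

namespace Summit.RiemannHypothesis.RiemannHypothesis.Theorems.IntegerScrew

open Literature.NumberTheory.LFunctions Filter Finset
open scoped Topology

/-- **`0 ≤ Δ²[k log k] ≤ 3/k` for `k ≥ 2`:** with `x = k`,
`Δ²[x log x] = x·log(1 − 1/x²) + log((x+1)/(x−1))` and `1 − 1/y ≤ log y ≤ y − 1`. [folklore] -/
theorem secondDiff_mul_log_bounds (k : ℕ) (hk : 2 ≤ k) :
    0 ≤ ((k : ℝ) + 1) * Real.log ((k : ℝ) + 1) - 2 * ((k : ℝ) * Real.log k)
        + ((k : ℝ) - 1) * Real.log ((k : ℝ) - 1) ∧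
    ((k : ℝ) + 1) * Real.log ((k : ℝ) + 1) - 2 * ((k : ℝ) * Real.log k)
        + ((k : ℝ) - 1) * Real.log ((k : ℝ) - 1) ≤ 3 / (k : ℝ) := by
  set x : ℝ := (k : ℝ) with hx
  have hx2 : (2 : ℝ) ≤ x := by rw [hx]; exact_mod_cast hk
  have hx0 : 0 < x := by linarith
  have hxp : 0 < x + 1 := by linarith
  have hxm : 0 < x - 1 := by linarith
  -- A = log(1 − 1/x²), B = log((x+1)/(x−1))
  set A : ℝ := Real.log ((x + 1) * (x - 1) / x ^ 2) with hA
  set B : ℝ := Real.log ((x + 1) / (x - 1)) with hB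
  have hAe : A = Real.log (x + 1) + Real.log (x - 1) - 2 * Real.log x := by
    rw [hA, Real.log_div (by positivity) (by positivity), Real.log_mul hxp.ne' hxm.ne', Real.log_pow]
    push_cast; ring
  have hBe : B = Real.log (x + 1) - Real.log (x - 1) := by
    rw [hB, Real.log_div hxp.ne' hxm.ne']
  have hE : (x + 1) * Real.log (x + 1) - 2 * (x * Real.log x) + (x - 1) * Real.log (x - 1)
      = x * A + B := by rw [hAe, hBe]; ring
  rw [hE]
  -- bounds for A: y = (x+1)(x−1)/x² ∈ (0, 1)
  have hy0 : 0 < (x + 1) * (x - 1) / x ^ 2 := by positivity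
  have hAhi : A ≤ (x + 1) * (x - 1) / x ^ 2 - 1 := Real.log_le_sub_one_of_pos hy0
  have hAlo : 1 - ((x + 1) * (x - 1) / x ^ 2)⁻¹ ≤ A := Real.one_sub_inv_le_log_of_pos hy0
  -- bounds for B: z = (x+1)/(x−1) > 0
  have hz0 : 0 < (x + 1) / (x - 1) := by positivity
  have hBhi : B ≤ (x + 1) / (x - 1) - 1 := Real.log_le_sub_one_of_pos hz0
  have hBlo : 1 - ((x + 1) / (x - 1))⁻¹ ≤ B := Real.one_sub_inv_le_log_of_pos hz0
  -- simplify the rational bounds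
  have e1 : (x + 1) * (x - 1) / x ^ 2 - 1 = -(1 / x ^ 2) := by field_simp; ring
  have e2 : 1 - ((x + 1) * (x - 1) / x ^ 2)⁻¹ = -(1 / ((x + 1) * (x - 1))) := by
    field_simp; ring
  have e3 : (x + 1) / (x - 1) - 1 = 2 / (x - 1) := by field_simp; ring
  have e4 : 1 - ((x + 1) / (x - 1))⁻¹ = 2 / (x + 1) := by field_simp; ring
  rw [e1] at hAhi; rw [e2] at hAlo; rw [e3] at hBhi; rw [e4] at hBlo
  constructor
  · -- x·A + B ≥ −x/((x+1)(x−1)) + 2/(x+1) = (x−2)/((x+1)(x−1)) ≥ 0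
    have h1 : x * (-(1 / ((x + 1) * (x - 1)))) ≤ x * A := mul_le_mul_of_nonneg_left hAlo hx0.le
    have h2 : 0 ≤ x * (-(1 / ((x + 1) * (x - 1)))) + 2 / (x + 1) := by
      have : x * (-(1 / ((x + 1) * (x - 1)))) + 2 / (x + 1) = (x - 2) / ((x + 1) * (x - 1)) := by
        field_simp; ring
      rw [this]; exact div_nonneg (by linarith) (by positivity)
    linarith
  · -- x·A + B ≤ −1/x + 2/(x−1) = (x+1)/(x(x−1)) ≤ 3/x
    have h1 : x * A ≤ x * (-(1 / x ^ 2)) := mul_le_mul_of_nonneg_left hAhi hx0.le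
    have h2 : x * (-(1 / x ^ 2)) + 2 / (x - 1) ≤ 3 / x := by
      rw [show x * (-(1 / x ^ 2)) + 2 / (x - 1) = (x + 1) / (x * (x - 1)) by field_simp; ring,
        div_le_div_iff₀ (by positivity) hx0]
      nlinarith
    linarith

/-- The squares `(c_k/2)²` are summable (`(c_k/2)² ≤ 9/(4k²)`). [folklore] -/
theorem summable_pivotLagCoeff_sq :
    Summable fun k : ℕ => (-(((k : ℝ) + 1) * Real.log ((k : ℝ) + 1) - 2 * ((k : ℝ) * Real.log k)
      + ((k : ℝ) - 1) * Real.log ((k : ℝ) - 1)) / 2) ^ 2 := by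
  -- compare with 9/4 · 1/k² from k = 2 on
  have hcmp : Summable fun k : ℕ => (9 / 4 : ℝ) * (1 / (k : ℝ) ^ 2) := by
    refine Summable.mul_left _ ?_
    exact (Real.summable_one_div_nat_pow (p := 2)).mpr one_lt_two
  refine (summable_nat_add_iff 2).mp ?_
  refine Summable.of_nonneg_of_le (fun k => sq_nonneg _) (fun k => ?_) ((summable_nat_add_iff 2).mpr hcmp)
  obtain ⟨h0, h3⟩ := secondDiff_mul_log_bounds (k + 2) (by omega)
  have hk0 : (0 : ℝ) < ((k + 2 : ℕ) : ℝ) := by positivity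
  push_cast at h0 h3 hk0 ⊢
  have hsq : (-(((k : ℝ) + 2 + 1) * Real.log ((k : ℝ) + 2 + 1) - 2 * (((k : ℝ) + 2) * Real.log ((k : ℝ) + 2))
      + ((k : ℝ) + 2 - 1) * Real.log ((k : ℝ) + 2 - 1)) / 2) ^ 2
      = (((k : ℝ) + 2 + 1) * Real.log ((k : ℝ) + 2 + 1) - 2 * (((k : ℝ) + 2) * Real.log ((k : ℝ) + 2))
      + ((k : ℝ) + 2 - 1) * Real.log ((k : ℝ) + 2 - 1)) ^ 2 / 4 := by ring
  rw [hsq, div_le_iff₀ (by norm_num : (0 : ℝ) < 4)]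
  have hb : (((k : ℝ) + 2 + 1) * Real.log ((k : ℝ) + 2 + 1) - 2 * (((k : ℝ) + 2) * Real.log ((k : ℝ) + 2))
      + ((k : ℝ) + 2 - 1) * Real.log ((k : ℝ) + 2 - 1)) ^ 2 ≤ (3 / ((k : ℝ) + 2)) ^ 2 :=
    pow_le_pow_left₀ h0 h3 2
  have e : (3 / ((k : ℝ) + 2)) ^ 2 = 9 / 4 * (1 / ((k : ℝ) + 2) ^ 2) * 4 := by
    field_simp; ring
  linarith

/-- **THE CONTINUUM FLOOR (series form).**  For every `δ > 0`, eventually in `M`: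
`S_{M−1} ≻ 0 → Σ'_k (c_k/2)² − δ ≤ G(M)·log M`, `G(M) = M·(2Ψ(log(M/(M−1))) − d_M)`; the series is
`¼Σ_{k≥1}(Δ²[k log k])² = V/2`, the Szegő continuum constant (PIVOT-LAW §15.4; the `k = 0` term is `0`).
[folklore] -/
theorem eventually_deficit_floor_series (δ : ℝ) (hδ : 0 < δ) :
    ∀ᶠ M : ℕ in atTop, (screwMatrix (M - 2)).PosDef →
      (∑' k : ℕ, (-(((k : ℝ) + 1) * Real.log ((k : ℝ) + 1) - 2 * ((k : ℝ) * Real.log k)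
          + ((k : ℝ) - 1) * Real.log ((k : ℝ) - 1)) / 2) ^ 2) - δ ≤
        (M : ℝ) * (2 * zetaScrew (Real.log ((M : ℝ) / ((M : ℝ) - 1))) - screwPivot M)
          * Real.log (M : ℝ) := by
  set f : ℕ → ℝ := fun k => (-(((k : ℝ) + 1) * Real.log ((k : ℝ) + 1) - 2 * ((k : ℝ) * Real.log k)
      + ((k : ℝ) - 1) * Real.log ((k : ℝ) - 1)) / 2) ^ 2 with hf
  have hsum : Summable f := summable_pivotLagCoeff_sq
  -- the k = 0 term vanishes (log(−1) = log 1 = 0)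
  have hf0 : f 0 = 0 := by
    simp [hf, Real.log_one]
  -- partial sums over `range (K+1)` approach the sum: pick K with Σ_{k≤K} f ≥ tsum − δ/2
  have ht := hsum.hasSum.tendsto_sum_nat
  have hev := ht.eventually (lt_mem_nhds (sub_lt_self (∑' k, f k) (half_pos hδ)))
  obtain ⟨N, hN⟩ := eventually_atTop.1 hev
  have hK := hN (N + 1) (by omega)
  -- Σ_{k < N+1} f = Σ_{k ∈ Icc 1 N} f
  have hsplit : ∑ k ∈ range (N + 1), f k = ∑ k ∈ Icc 1 N, f k := by
    rw [Finset.sum_range_succ', hf0, add_zero,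
      show Finset.Icc 1 N = Finset.Ico 1 (N + 1) from rfl, Finset.sum_Ico_eq_sum_range,
      Nat.add_sub_cancel]
    exact Finset.sum_congr rfl fun k _ => by rw [add_comm]
  rw [hsplit] at hK
  -- the K-node floor with ε = δ/2
  filter_upwards [eventually_kNode_deficit_floor N (δ / 2) (half_pos hδ)] with M hM hPD
  have h := hM hPD
  simp only [hf] at hK
  linarith

/-- Under RH: for every `δ > 0`, eventually `Σ'_k (c_k/2)² − δ ≤ G(M)·log M`. [folklore] -/
theorem eventually_deficit_floor_series_of_riemannHypothesis (hRH : _root_.RiemannHypothesis)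
    (δ : ℝ) (hδ : 0 < δ) :
    ∀ᶠ M : ℕ in atTop,
      (∑' k : ℕ, (-(((k : ℝ) + 1) * Real.log ((k : ℝ) + 1) - 2 * ((k : ℝ) * Real.log k)
          + ((k : ℝ) - 1) * Real.log ((k : ℝ) - 1)) / 2) ^ 2) - δ ≤
        (M : ℝ) * (2 * zetaScrew (Real.log ((M : ℝ) / ((M : ℝ) - 1))) - screwPivot M)
          * Real.log (M : ℝ) :=
  (eventually_deficit_floor_series δ hδ).mono fun M hM =>
    hM (screwMatrix_posDef_of_riemannHypothesis hRH (M - 2))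

end Summit.RiemannHypothesis.RiemannHypothesis.Theorems.IntegerScrew
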